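import Summits.QuantumFields.YangMills.Theorems.ColdStartUniversalityLatticeLangevinLezaudSkeletonUniform
import Literature.Analysis.Asymptotics.StepRatioRiemannSum
import HarnessLib

/-!
# Route `ColdStartUniversality` (fixed-cut-off SZZ dynamics, sampler statistics): ★★★ LEZAUD'S BERNSTEIN INEQUALITY FOR TIME AVERAGES —
# VOLUME-FREE exponential concentration of `T⁻¹∫₀ᵀ G(U_{a+r}) dr` for EVERY bounded continuous observable after the `O(log L)` burn-in

Helper file (seat `ym-line-csu-p1`, g37; `--supports stmt-QuantumFields-24809`).  SU(2) lattice Langevin dynamics of Shen–Zhu–Zhu at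
`(L, β')` with `|β'| < 1/12` (`λ = 1 − 12|β'|`), Wilson measure `μ = μ_{β'}`, strong solutions `U` from a deterministic start on ANY filtered
probability space, burn-in `a = 2 + t₀ + u`, `log B ≤ 2λt₀` (`B = O(L³)`, `t₀ = O(log L)`).  The discrete Feynman–Kac bound of
`…LezaudSkeletonUniform` along the steps `h = T/(n+1) → 0` (a.s. continuous paths, left Riemann sums of the continuous function
`r ↦ G(U_{a+r})`, dominated convergence; `m_h ≤ 1 + hΛ(θ) + O(h²)` by `lezaud_rate_bound`) gives:

* ★★★ `coldStart_integral_exp_timeIntegral_le_uniform` — for EVERY bounded continuous `G` with `|G − μG| ≤ b`, `Var_μ(G) ≤ σ²`, every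
  `0 ≤ θ` with `θb < λ` and every `T > 0`:  `E[exp(θ(∫_{(0,T]} G(U_{a+r}) dr − T·μG))] ≤ e · exp(T·θ²σ²/(λ − θb))`
  — the exponential moment of the time integral is that of Lezaud's comparison, `Λ(θ) ≤ θ²σ²/(λ − θb)`, with the warm-start factor `e`;
* ★★★ `coldStart_timeAverage_tail_le_bernstein_uniform` — BERNSTEIN'S INEQUALITY (`θ = λε/(2σ² + bε)`):
  `P[ T⁻¹∫_{(0,T]} G(U_{2+t₀+u+r}) dr − μ_{β'}G ≥ ε ] ≤ e · exp(−λTε²/(4σ² + 2bε))`;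
* ★★★ `coldStart_timeAverage_deviation_le_bernstein_uniform` — two-sided, `|G| ≤ 1`:
  `P[ |T⁻¹∫_{(0,T]} G(U_{2+t₀+u+r}) dr − μ_{β'}G| ≥ ε ] ≤ 2e · exp(−λTε²/(4σ² + 4ε))`.

NONE of the constants depends on `L`: compare g34's `…TimeAverageHoeffding` (`2·exp(−cTε²/(576C))`, Harris `C, c` of the volume) and
`…TimeAverageHoeffdingUniform` (volume-free for LOCAL `C⁵` observables only); here `G` is ANY bounded continuous observable (macroscopic
ones included) and the rate carries the VARIANCE `σ²`, at the price of the burn-in `2 + t₀ = O(log L)` and the prefactor `e`.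
[cite: Lezaud2001, Theorem 1.1 and Remark 1.2] [cite: DiaconisSaloffcoste1996, Theorem 3.7].  THEOREMS ONLY, no definition, no sorry.
HONEST FRAMING: RECORD-rung R3 plumbing at FIXED cut-off in LATTICE units; "volume-free" refers to `L` at fixed `|β'| < 1/12`; the route's
scaling `β'_K → ∞` leaves the window; `UniformColdStartMixing` (24809) is NOT restated; nothing K-uniform is proved; no crux, rung or summit
statement is proved; the Yang–Mills mass gap is NOT proved.
-/

set_option autoImplicit false

noncomputable section

namespace Summit.QuantumFields.YangMills.Theorems.ColdStartUniversality

open MeasureTheory ProbabilityTheory Filter Set Topology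
open scoped BigOperators NNReal ENNReal
open Literature.Probability.Process Literature.MathematicalPhysics.QuantumFieldTheory
open Literature.MathematicalPhysics.QuantumLattice (fundamentalRep fundamentalLatticeRep continuous_fundamentalRep)

variable {L : ℕ} [NeZero L]

/-! ## §1. Two real lemmas -/

/-- `m ≤ 1 + hΛ + h²C`, `0 ≤ m` and `nh ≤ T` give `mⁿ ≤ exp(T(Λ + hC))` (`Λ, C, h ≥ 0`). [folklore] -/
theorem pow_le_exp_of_le_one_add {m Λ C h T : ℝ} {n : ℕ} (hm0 : 0 ≤ m) (hm : m ≤ 1 + h * Λ + h ^ 2 * C) (hΛ : 0 ≤ Λ)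
    (hC : 0 ≤ C) (hh : 0 ≤ h) (hnh : (n : ℝ) * h ≤ T) : m ^ n ≤ Real.exp (T * (Λ + h * C)) := by
  have h1 : m ≤ Real.exp (h * Λ + h ^ 2 * C) :=
    hm.trans (by have := Real.add_one_le_exp (h * Λ + h ^ 2 * C); linarith)
  calc m ^ n ≤ Real.exp (h * Λ + h ^ 2 * C) ^ n := pow_le_pow_left₀ hm0 h1 n
    _ = Real.exp (n * (h * Λ + h ^ 2 * C)) := by rw [← Real.exp_nat_mul]
    _ ≤ Real.exp (T * (Λ + h * C)) := Real.exp_le_exp.2 (by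
        have e : (n : ℝ) * (h * Λ + h ^ 2 * C) = ((n : ℝ) * h) * (Λ + h * C) := by ring
        rw [e]; exact mul_le_mul_of_nonneg_right hnh (by positivity))

/-- Lezaud's Bernstein exponent: with `θ = λε/(2σ² + bε)` one has `0 ≤ θ`, `θb < λ` and
`T·θ²σ²/(λ − θb) − θTε = −λTε²/(4σ² + 2bε)`. [cite: Lezaud2001, Remark 1.2] -/
theorem lezaud_bernstein_exponent {lam b σ ε T : ℝ} (hlam : 0 < lam) (hb : 0 ≤ b) (hσ : 0 < σ) (hε : 0 < ε) :
    0 ≤ lam * ε / (2 * σ ^ 2 + b * ε) ∧ lam * ε / (2 * σ ^ 2 + b * ε) * b < lam ∧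
      T * ((lam * ε / (2 * σ ^ 2 + b * ε)) ^ 2 * σ ^ 2 / (lam - lam * ε / (2 * σ ^ 2 + b * ε) * b)) -
          lam * ε / (2 * σ ^ 2 + b * ε) * T * ε =
        -(lam * T * ε ^ 2 / (4 * σ ^ 2 + 2 * b * ε)) := by
  set d : ℝ := 2 * σ ^ 2 + b * ε with hd
  have hd0 : 0 < d := by positivity
  refine ⟨by positivity, ?_, ?_⟩
  · rw [div_mul_eq_mul_div, div_lt_iff₀ hd0, hd]; nlinarith [mul_pos hlam (pow_pos hσ 2)]
  · have h1 : lam - lam * ε / d * b = 2 * lam * σ ^ 2 / d := by rw [hd]; field_simp; ring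
    have h2 : (lam * ε / d) ^ 2 * σ ^ 2 / (lam - lam * ε / d * b) = lam * ε ^ 2 / (2 * d) := by
      rw [h1]; field_simp
    rw [h2, hd]; field_simp; ring

/-! ## §2. The exponential moment of the time integral -/

/-- ★★★ **VOLUME-FREE EXPONENTIAL MOMENT OF THE TIME INTEGRAL (Lezaud's Feynman–Kac bound), `|β'| < 1/12`.**  For every `L`,
`|β'| < 1/12` (`λ := 1 − 12|β'|`), every deterministic start `z`, EVERY strong solution `U` from `z` on ANY filtered probability space,
EVERY bounded continuous `G` with `|G − μ_{β'}G| ≤ b` (`b ≥ 0`) and `Var_{μ_{β'}}(G) ≤ σ²` (`σ > 0`), every `0 ≤ θ` with `θb < λ`, all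
`t₀, u` with `log B ≤ 2λt₀` and every `T > 0`:

  `∫ exp(θ · (∫_{(0,T]} G(U_{2+t₀+u+r}) dr − T·μ_{β'}G)) dP ≤ e · exp(T · θ²σ²/(λ − θb))`.

Limit `h = T/(n+1) → 0` of `coldStart_integral_exp_skeleton_sum_le_uniform` (left Riemann sums along a.s. continuous paths, dominated
convergence, `lezaud_rate_bound`).  No constant depends on `L`. [cite: Lezaud2001, Theorem 1.1 and Remark 1.2] -/
theorem coldStart_integral_exp_timeIntegral_le_uniform (L : ℕ) [NeZero L] (β' : ℝ) (hβ : |β'| < 1 / 12)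
    (z : GaugeConfig 3 L (Matrix.specialUnitaryGroup (Fin 2) ℂ))
    {Ω : Type} [MeasurableSpace Ω] {P : Measure Ω} [IsProbabilityMeasure P]
    {W : ℝ≥0 → Ω → (Edge 3 L × NoiseIdx 2 → ℝ)} (hW : IsFlatBrownian W P)
    {U : ℝ≥0 → Ω → GaugeConfig 3 L (Matrix.specialUnitaryGroup (Fin 2) ℂ)} (hU0 : ∀ ω, U 0 ω = z)
    (hU : (latticeLangevinDynamics (fundamentalLatticeRep 2) β').IsSolution (fundamentalRep (Fin 2)) hW.natFiltration P W U)
    {G : GaugeConfig 3 L (Matrix.specialUnitaryGroup (Fin 2) ℂ) → ℝ} (hG : Continuous G) {b σ : ℝ} (hb : 0 ≤ b)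
    (hGb : ∀ x, |G x - ∫ y, G y ∂(wilsonMeasure (d := 3) (L := L) (fundamentalRep (Fin 2)) β')| ≤ b) (hσ : 0 < σ)
    (hσ2 : ∫ x, (G x - ∫ y, G y ∂(wilsonMeasure (d := 3) (L := L) (fundamentalRep (Fin 2)) β')) ^ 2
      ∂(wilsonMeasure (d := 3) (L := L) (fundamentalRep (Fin 2)) β') ≤ σ ^ 2)
    {θ : ℝ} (hθ : 0 ≤ θ) (hθb : θ * b < 1 - 12 * |β'|) (t₀ u : ℝ≥0)
    (ht₀ : Real.log (96 * |β'| * (Fintype.card (Edge 3 L) : ℝ) + 10 * |β'| * (Fintype.card (Plaquette 3 L) : ℝ) + Real.log 2 +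
      (Fintype.card (Edge 3 L) : ℝ) * Real.log (3 / 2)) ≤ 2 * (1 - 12 * |β'|) * t₀)
    {T : ℝ} (hT : 0 < T) :
    Integrable (fun ω => Real.exp (θ * ((∫ r in Ioc 0 T, G (U (2 + t₀ + u + r.toNNReal) ω)) -
        T * ∫ y, G y ∂(wilsonMeasure (d := 3) (L := L) (fundamentalRep (Fin 2)) β')))) P ∧
    ∫ ω, Real.exp (θ * ((∫ r in Ioc 0 T, G (U (2 + t₀ + u + r.toNNReal) ω)) -
        T * ∫ y, G y ∂(wilsonMeasure (d := 3) (L := L) (fundamentalRep (Fin 2)) β'))) ∂P ≤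
      Real.exp 1 * Real.exp (T * (θ ^ 2 * σ ^ 2 / ((1 - 12 * |β'|) - θ * b))) := by
  classical
  haveI := secondCountableTopology_su2
  haveI := borelSpace_config L
  set lam : ℝ := 1 - 12 * |β'| with hlamdef
  have hlam : 0 < lam := by rw [hlamdef]; linarith
  have hd : 0 < lam - θ * b := by linarith
  set m : ℝ := ∫ y, G y ∂(wilsonMeasure (d := 3) (L := L) (fundamentalRep (Fin 2)) β') with hm
  set a : ℝ≥0 := 2 + t₀ + u with ha
  have hGm : Measurable G := hG.measurable
  have hmU : ∀ r : ℝ≥0, Measurable (U r) := fun r => (hU.adapted r).mono (hW.natFiltration.le r) le_rfl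
  -- the steps `h_n = T/(n+1)`
  set hN : ℕ → ℝ≥0 := fun n => T.toNNReal / ((n : ℝ≥0) + 1) with hhN
  have hNreal : ∀ n : ℕ, (hN n : ℝ) = T / ((n : ℝ) + 1) := fun n => by
    simp only [hhN, NNReal.coe_div, Real.coe_toNNReal T hT.le, NNReal.coe_add, NNReal.coe_natCast, NNReal.coe_one]
  have hNpos : ∀ n : ℕ, 0 < (hN n : ℝ) := fun n => by rw [hNreal]; positivity
  have hNT : ∀ n : ℕ, ((n : ℝ) + 1) * (hN n : ℝ) = T := fun n => by
    rw [hNreal]; field_simp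
  have hnT : ∀ n : ℕ, (n : ℝ) * (hN n : ℝ) ≤ T := fun n => by linarith [hNT n, (hNpos n).le]
  have hN0 : Tendsto (fun n => (hN n : ℝ)) atTop (𝓝 0) := by
    have h := (tendsto_one_div_add_atTop_nhds_zero_nat (𝕜 := ℝ)).const_mul T
    rw [mul_zero] at h
    refine h.congr fun n => ?_
    rw [hNreal]; ring
  -- the skeleton functionals and their limit
  set F : ℕ → Ω → ℝ := fun n ω =>
    Real.exp (θ * (hN n : ℝ) * ∑ k ∈ Finset.range (n + 1), (G (U (a + (k : ℝ≥0) * hN n) ω) - m)) with hFdef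
  set Fl : Ω → ℝ := fun ω => Real.exp (θ * ((∫ r in Ioc 0 T, G (U (a + r.toNNReal) ω)) - T * m)) with hFldef
  have hFm : ∀ n, Measurable (F n) := fun n =>
    Real.measurable_exp.comp ((Finset.measurable_sum _ fun k _ => (hGm.comp (hmU _)).sub measurable_const).const_mul _)
  have hFb : ∀ n ω, |F n ω| ≤ Real.exp (θ * (T * b)) := by
    intro n ω
    rw [hFdef]; dsimp only
    rw [abs_of_pos (Real.exp_pos _)]
    refine Real.exp_le_exp.2 ?_
    have hs : ∑ k ∈ Finset.range (n + 1), (G (U (a + (k : ℝ≥0) * hN n) ω) - m) ≤ ((n : ℝ) + 1) * b :=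
      calc ∑ k ∈ Finset.range (n + 1), (G (U (a + (k : ℝ≥0) * hN n) ω) - m)
          ≤ ∑ _k ∈ Finset.range (n + 1), b := Finset.sum_le_sum fun k _ => (le_abs_self _).trans (hGb _)
        _ = ((n : ℝ) + 1) * b := by rw [Finset.sum_const, Finset.card_range, nsmul_eq_mul]; push_cast; ring
    calc θ * (hN n : ℝ) * ∑ k ∈ Finset.range (n + 1), (G (U (a + (k : ℝ≥0) * hN n) ω) - m)
        ≤ θ * (hN n : ℝ) * (((n : ℝ) + 1) * b) := mul_le_mul_of_nonneg_left hs (mul_nonneg hθ (hNpos n).le)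
      _ = θ * ((((n : ℝ) + 1) * (hN n : ℝ)) * b) := by ring
      _ = θ * (T * b) := by rw [hNT n]
  have hlim : ∀ᵐ ω ∂P, Tendsto (fun n => F n ω) atTop (𝓝 (Fl ω)) := by
    filter_upwards [hU.continuous] with ω hω
    have hg : Continuous fun r : ℝ => G (U (a + r.toNNReal) ω) :=
      hG.comp (hω.comp (continuous_const.add continuous_real_toNNReal))
    have hR := Literature.Analysis.Asymptotics.tendsto_mul_sum_range_intervalIntegral (l := atTop)
      (f := fun r : ℝ => G (U (a + r.toNNReal) ω)) hg hT.le (h := fun n : ℕ => (hN n : ℝ)) (N := fun n : ℕ => n + 1)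
      (tendsto_nhdsWithin_iff.2 ⟨hN0, Eventually.of_forall fun n => hNpos n⟩)
      (by
        have e : (fun n : ℕ => (((n + 1 : ℕ) : ℝ)) * (hN n : ℝ)) = fun _ => T := funext fun n => by push_cast; exact hNT n
        rw [e]; exact tendsto_const_nhds)
    rw [intervalIntegral.integral_of_le hT.le] at hR
    -- rewrite `F n ω` through the Riemann sum of `g`
    have hk : ∀ (n k : ℕ), a + (k : ℝ≥0) * hN n = a + ((k : ℝ) * (hN n : ℝ)).toNNReal := fun n k => by
      congr 1; apply NNReal.eq; rw [Real.coe_toNNReal _ (by positivity)]; push_cast; ring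
    have e2 : ∀ n, F n ω = Real.exp (θ * ((hN n : ℝ) * ∑ k ∈ Finset.range (n + 1), G (U (a + ((k : ℝ) * (hN n : ℝ)).toNNReal) ω) -
        T * m)) := by
      intro n
      rw [hFdef]; dsimp only
      have hsum1 : ∑ k ∈ Finset.range (n + 1), (G (U (a + (k : ℝ≥0) * hN n) ω) - m) =
          ∑ k ∈ Finset.range (n + 1), (G (U (a + ((k : ℝ) * (hN n : ℝ)).toNNReal) ω) - m) :=
        Finset.sum_congr rfl fun k _ => by rw [hk n k]
      rw [hsum1, Finset.sum_sub_distrib, Finset.sum_const, Finset.card_range, nsmul_eq_mul, Nat.cast_add_one]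
      congr 1
      calc θ * (hN n : ℝ) * ((∑ k ∈ Finset.range (n + 1), G (U (a + ((k : ℝ) * (hN n : ℝ)).toNNReal) ω)) - ((n : ℝ) + 1) * m)
          = θ * ((hN n : ℝ) * (∑ k ∈ Finset.range (n + 1), G (U (a + ((k : ℝ) * (hN n : ℝ)).toNNReal) ω)) -
              (((n : ℝ) + 1) * (hN n : ℝ)) * m) := by ring
        _ = _ := by rw [hNT n]
    have e3 : (fun n => F n ω) = fun n => Real.exp (θ * ((hN n : ℝ) *
        ∑ k ∈ Finset.range (n + 1), G (U (a + ((k : ℝ) * (hN n : ℝ)).toNNReal) ω) - T * m)) := funext e2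
    rw [e3, hFldef]
    exact (Real.continuous_exp.tendsto _).comp ((hR.sub_const (T * m)).const_mul θ)
  -- dominated convergence; measurability and integrability of the limit
  have hconv : Tendsto (fun n => ∫ ω, F n ω ∂P) atTop (𝓝 (∫ ω, Fl ω ∂P)) :=
    tendsto_integral_of_dominated_convergence (fun _ => Real.exp (θ * (T * b))) (fun n => (hFm n).aestronglyMeasurable)
      (integrable_const _) (fun n => ae_of_all _ fun ω => by rw [Real.norm_eq_abs]; exact hFb n ω) hlim
  have hFl_meas : AEStronglyMeasurable Fl P :=
    aestronglyMeasurable_of_tendsto_ae atTop (fun n => (hFm n).aestronglyMeasurable) hlim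
  have hFl_int : Integrable Fl P :=
    (integrable_const (Real.exp (θ * (T * b)))).mono' hFl_meas (by
      filter_upwards [hlim] with ω hω
      rw [Real.norm_eq_abs]
      exact le_of_tendsto' ((continuous_abs.tendsto _).comp hω) fun n => hFb n ω)
  refine ⟨hFl_int, ?_⟩
  -- the discrete bounds, eventually in `n`
  set Λ : ℝ := θ ^ 2 * σ ^ 2 / (lam - θ * b) with hΛ
  set C : ℝ := 2 * θ ^ 2 * σ ^ 2 * lam ^ 2 / (lam - θ * b) ^ 2 + θ ^ 2 * b ^ 2 + 3 * lam * θ * b with hC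
  have hΛ0 : 0 ≤ Λ := by rw [hΛ]; positivity
  have hC0 : 0 ≤ C := by rw [hC]; positivity
  set g : ℕ → ℝ := fun n => Real.exp 1 * Real.exp (θ * (hN n : ℝ) * b) * Real.exp (T * (Λ + (hN n : ℝ) * C)) with hgdef
  have hδ : 0 < min (1 / lam) (min (1 / (θ * b + 1)) ((lam - θ * b) / (2 * lam ^ 2))) :=
    lt_min (by positivity) (lt_min (by positivity) (div_pos hd (by positivity)))
  have hev : ∀ᶠ n in atTop, ∫ ω, F n ω ∂P ≤ g n := by
    filter_upwards [hN0.eventually (gt_mem_nhds hδ)] with n hn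
    have hh := hNpos n
    have h1 : lam * (hN n : ℝ) ≤ 1 := by
      have := (lt_min_iff.1 hn).1
      rw [lt_div_iff₀ hlam] at this; linarith
    have h2 : θ * (hN n : ℝ) * b ≤ 1 := by
      have := (lt_min_iff.1 (lt_min_iff.1 hn).2).1
      rw [lt_div_iff₀ (by positivity)] at this; nlinarith [mul_nonneg hθ hb]
    have h3 : 2 * lam ^ 2 * (hN n : ℝ) ≤ lam - θ * b := by
      have := (lt_min_iff.1 (lt_min_iff.1 hn).2).2
      rw [lt_div_iff₀ (by positivity)] at this; linarith
    obtain ⟨hc, hmle⟩ := FeynmanKac.lezaud_rate_bound (σ := σ) hlam hθ hb hθb hh h1 h3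
    have hdisc := coldStart_integral_exp_skeleton_sum_le_uniform L β' hβ z hW hU0 hU hGm hb hGb hσ hσ2 hθ t₀ u (hN n) ht₀ hh h2 hc n
    rw [← hm] at hdisc
    -- `m_h ≥ 0` and `m_hⁿ ≤ exp(T(Λ + hC))`
    have hr1 : Real.exp (-(lam * (hN n : ℝ))) ≤ 1 := Real.exp_le_one_iff.2 (by nlinarith)
    have hm0 : 0 ≤ 1 + Real.exp (-(lam * (hN n : ℝ))) ^ 2 * (θ * (hN n : ℝ)) ^ 2 * σ ^ 2 /
        (1 - Real.exp (-(lam * (hN n : ℝ))) - Real.exp (-(lam * (hN n : ℝ))) * (θ * (hN n : ℝ) * b)) +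
        Real.exp (-(lam * (hN n : ℝ))) * (θ * (hN n : ℝ) * b) ^ 2 + 3 * (1 - Real.exp (-(lam * (hN n : ℝ)))) * (θ * (hN n : ℝ) * b) :=
      add_nonneg (add_nonneg (add_nonneg zero_le_one (div_nonneg (by positivity) hc.le)) (by positivity))
        (mul_nonneg (mul_nonneg (by norm_num) (sub_nonneg.2 hr1)) (by positivity))
    have hpow := pow_le_exp_of_le_one_add (n := n) hm0 hmle hΛ0 hC0 hh.le (hnT n)
    calc ∫ ω, F n ω ∂P ≤ Real.exp 1 * Real.exp (θ * (hN n : ℝ) * b) * _ := hdisc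
      _ ≤ Real.exp 1 * Real.exp (θ * (hN n : ℝ) * b) * Real.exp (T * (Λ + (hN n : ℝ) * C)) :=
          mul_le_mul_of_nonneg_left hpow (by positivity)
  -- the limit of the discrete bounds
  have hglim : Tendsto g atTop (𝓝 (Real.exp 1 * Real.exp (θ * 0 * b) * Real.exp (T * (Λ + 0 * C)))) := by
    refine (tendsto_const_nhds.mul ((Real.continuous_exp.tendsto _).comp ((hN0.const_mul θ).mul_const b))).mul
      ((Real.continuous_exp.tendsto _).comp ((tendsto_const_nhds.add (hN0.mul_const C)).const_mul T))
  simp only [mul_zero, zero_mul, Real.exp_zero, mul_one, add_zero] at hglim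
  exact le_of_tendsto_of_tendsto hconv hglim hev

/-! ## §3. Bernstein's inequality for time averages -/

/-- ★★★ **LEZAUD'S BERNSTEIN INEQUALITY FOR TIME AVERAGES OF THE COLD-START SAMPLER — VOLUME-FREE after the `O(log L)` burn-in,
`|β'| < 1/12`.**  For every `L`, `|β'| < 1/12` (`λ := 1 − 12|β'|`), every deterministic start `z`, EVERY strong solution `U` from `z` on
ANY filtered probability space, EVERY bounded continuous observable `G` with `|G − μ_{β'}G| ≤ b` (`b ≥ 0`) and `Var_{μ_{β'}}(G) ≤ σ²`
(`σ > 0`), all `t₀, u` with `log B ≤ 2λt₀` (`B = 96|β'|#E + 10|β'|#𝒫 + log 2 + #E·log(3/2)`), every `T > 0` and every `ε > 0`: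

  `P[ T⁻¹ ∫_{(0,T]} G(U_{2+t₀+u+r}) dr − ∫ G dμ_{β'} ≥ ε ] ≤ e · exp(−λ·T·ε² / (4σ² + 2bε))`

— Gaussian behaviour `exp(−λTε²/(4σ²))` for small `ε` with the VARIANCE of `G`, Poissonian `exp(−λTε/(2b))` for large `ε`; neither the
rate nor the prefactor depends on `L` (Markov's inequality on `coldStart_integral_exp_timeIntegral_le_uniform` at `θ = λε/(2σ² + bε)`).
[cite: Lezaud2001, Theorem 1.1 and Remark 1.2] [cite: DiaconisSaloffcoste1996, Theorem 3.7] -/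
theorem coldStart_timeAverage_tail_le_bernstein_uniform (L : ℕ) [NeZero L] (β' : ℝ) (hβ : |β'| < 1 / 12)
    (z : GaugeConfig 3 L (Matrix.specialUnitaryGroup (Fin 2) ℂ))
    {Ω : Type} [MeasurableSpace Ω] {P : Measure Ω} [IsProbabilityMeasure P]
    {W : ℝ≥0 → Ω → (Edge 3 L × NoiseIdx 2 → ℝ)} (hW : IsFlatBrownian W P)
    {U : ℝ≥0 → Ω → GaugeConfig 3 L (Matrix.specialUnitaryGroup (Fin 2) ℂ)} (hU0 : ∀ ω, U 0 ω = z)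
    (hU : (latticeLangevinDynamics (fundamentalLatticeRep 2) β').IsSolution (fundamentalRep (Fin 2)) hW.natFiltration P W U)
    {G : GaugeConfig 3 L (Matrix.specialUnitaryGroup (Fin 2) ℂ) → ℝ} (hG : Continuous G) {b σ : ℝ} (hb : 0 ≤ b)
    (hGb : ∀ x, |G x - ∫ y, G y ∂(wilsonMeasure (d := 3) (L := L) (fundamentalRep (Fin 2)) β')| ≤ b) (hσ : 0 < σ)
    (hσ2 : ∫ x, (G x - ∫ y, G y ∂(wilsonMeasure (d := 3) (L := L) (fundamentalRep (Fin 2)) β')) ^ 2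
      ∂(wilsonMeasure (d := 3) (L := L) (fundamentalRep (Fin 2)) β') ≤ σ ^ 2)
    (t₀ u : ℝ≥0)
    (ht₀ : Real.log (96 * |β'| * (Fintype.card (Edge 3 L) : ℝ) + 10 * |β'| * (Fintype.card (Plaquette 3 L) : ℝ) + Real.log 2 +
      (Fintype.card (Edge 3 L) : ℝ) * Real.log (3 / 2)) ≤ 2 * (1 - 12 * |β'|) * t₀)
    {T : ℝ} (hT : 0 < T) {ε : ℝ} (hε : 0 < ε) :
    P.real {ω | ε ≤ T⁻¹ * (∫ r in Ioc 0 T, G (U (2 + t₀ + u + r.toNNReal) ω)) -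
        ∫ y, G y ∂(wilsonMeasure (d := 3) (L := L) (fundamentalRep (Fin 2)) β')} ≤
      Real.exp 1 * Real.exp (-((1 - 12 * |β'|) * T * ε ^ 2 / (4 * σ ^ 2 + 2 * b * ε))) := by
  classical
  haveI := secondCountableTopology_su2
  haveI := borelSpace_config L
  set lam : ℝ := 1 - 12 * |β'| with hlamdef
  have hlam : 0 < lam := by rw [hlamdef]; linarith
  set m : ℝ := ∫ y, G y ∂(wilsonMeasure (d := 3) (L := L) (fundamentalRep (Fin 2)) β') with hm
  obtain ⟨hθ, hθb, hexp⟩ := lezaud_bernstein_exponent (T := T) hlam hb hσ hε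
  set θ : ℝ := lam * ε / (2 * σ ^ 2 + b * ε) with hθdef
  obtain ⟨hFl_int, hmgf⟩ := coldStart_integral_exp_timeIntegral_le_uniform L β' hβ z hW hU0 hU hG hb hGb hσ hσ2 hθ hθb t₀ u ht₀ hT
  rw [← hm] at hmgf hFl_int
  set Fl : Ω → ℝ := fun ω => Real.exp (θ * ((∫ r in Ioc 0 T, G (U (2 + t₀ + u + r.toNNReal) ω)) - T * m)) with hFldef
  -- the event is contained in `{exp(θTε) ≤ Fl}`
  have hsub : {ω | ε ≤ T⁻¹ * (∫ r in Ioc 0 T, G (U (2 + t₀ + u + r.toNNReal) ω)) - m} ⊆ {ω | Real.exp (θ * T * ε) ≤ Fl ω} := by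
    intro ω hω
    simp only [Set.mem_setOf_eq] at hω ⊢
    rw [hFldef]
    refine Real.exp_le_exp.2 ?_
    have h1 : T * ε ≤ (∫ r in Ioc 0 T, G (U (2 + t₀ + u + r.toNNReal) ω)) - T * m := by
      have := mul_le_mul_of_nonneg_left hω hT.le
      rwa [mul_sub, ← mul_assoc, mul_inv_cancel₀ hT.ne', one_mul] at this
    calc θ * T * ε = θ * (T * ε) := by ring
      _ ≤ θ * ((∫ r in Ioc 0 T, G (U (2 + t₀ + u + r.toNNReal) ω)) - T * m) := mul_le_mul_of_nonneg_left h1 hθ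
  have hmarkov := mul_meas_ge_le_integral_of_nonneg (μ := P) (ae_of_all _ fun ω => (Real.exp_pos _).le) hFl_int (Real.exp (θ * T * ε))
  have hexp0 : 0 < Real.exp (θ * T * ε) := Real.exp_pos _
  calc P.real {ω | ε ≤ T⁻¹ * (∫ r in Ioc 0 T, G (U (2 + t₀ + u + r.toNNReal) ω)) - m}
      ≤ P.real {ω | Real.exp (θ * T * ε) ≤ Fl ω} := measureReal_mono hsub
    _ ≤ (∫ ω, Fl ω ∂P) / Real.exp (θ * T * ε) := by rw [le_div_iff₀ hexp0, mul_comm]; exact hmarkov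
    _ ≤ Real.exp 1 * Real.exp (T * (θ ^ 2 * σ ^ 2 / (lam - θ * b))) / Real.exp (θ * T * ε) :=
        div_le_div_of_nonneg_right hmgf hexp0.le
    _ = Real.exp 1 * Real.exp (T * (θ ^ 2 * σ ^ 2 / (lam - θ * b)) - θ * T * ε) := by
        rw [mul_div_assoc, ← Real.exp_sub]
    _ = Real.exp 1 * Real.exp (-(lam * T * ε ^ 2 / (4 * σ ^ 2 + 2 * b * ε))) := by rw [hexp]

/-- ★★★ **TWO-SIDED VOLUME-FREE BERNSTEIN INEQUALITY for time averages of bounded continuous observables, `|β'| < 1/12`.**  In the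
setting of `coldStart_timeAverage_tail_le_bernstein_uniform` with `|G| ≤ 1` (so `|G − μG| ≤ 2`) and `Var_{μ_{β'}}(G) ≤ σ²`, `σ > 0`:

  `P[ |T⁻¹ ∫_{(0,T]} G(U_{2+t₀+u+r}) dr − ∫ G dμ_{β'}| ≥ ε ] ≤ 2e · exp(−(1 − 12|β'|)·T·ε² / (4σ² + 4ε))`

for every `T > 0`, `ε > 0` — compare g34's `measureReal_timeAverage_deviation_le_exp` (`2·exp(−cTε²/(576C))`, Harris constants of the
volume, no variance) and g36's Chebyshev bound `8e/((1 − 12|β'|)Tε²)` after the same burn-in. [cite: Lezaud2001, Theorem 1.1 and Remark 1.2] -/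
theorem coldStart_timeAverage_deviation_le_bernstein_uniform (L : ℕ) [NeZero L] (β' : ℝ) (hβ : |β'| < 1 / 12)
    (z : GaugeConfig 3 L (Matrix.specialUnitaryGroup (Fin 2) ℂ))
    {Ω : Type} [MeasurableSpace Ω] {P : Measure Ω} [IsProbabilityMeasure P]
    {W : ℝ≥0 → Ω → (Edge 3 L × NoiseIdx 2 → ℝ)} (hW : IsFlatBrownian W P)
    {U : ℝ≥0 → Ω → GaugeConfig 3 L (Matrix.specialUnitaryGroup (Fin 2) ℂ)} (hU0 : ∀ ω, U 0 ω = z)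
    (hU : (latticeLangevinDynamics (fundamentalLatticeRep 2) β').IsSolution (fundamentalRep (Fin 2)) hW.natFiltration P W U)
    {G : GaugeConfig 3 L (Matrix.specialUnitaryGroup (Fin 2) ℂ) → ℝ} (hG : Continuous G) (hG1 : ∀ x, |G x| ≤ 1) {σ : ℝ} (hσ : 0 < σ)
    (hσ2 : ∫ x, (G x - ∫ y, G y ∂(wilsonMeasure (d := 3) (L := L) (fundamentalRep (Fin 2)) β')) ^ 2
      ∂(wilsonMeasure (d := 3) (L := L) (fundamentalRep (Fin 2)) β') ≤ σ ^ 2)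
    (t₀ u : ℝ≥0)
    (ht₀ : Real.log (96 * |β'| * (Fintype.card (Edge 3 L) : ℝ) + 10 * |β'| * (Fintype.card (Plaquette 3 L) : ℝ) + Real.log 2 +
      (Fintype.card (Edge 3 L) : ℝ) * Real.log (3 / 2)) ≤ 2 * (1 - 12 * |β'|) * t₀)
    {T : ℝ} (hT : 0 < T) {ε : ℝ} (hε : 0 < ε) :
    P.real {ω | ε ≤ |T⁻¹ * (∫ r in Ioc 0 T, G (U (2 + t₀ + u + r.toNNReal) ω)) -
        ∫ y, G y ∂(wilsonMeasure (d := 3) (L := L) (fundamentalRep (Fin 2)) β')|} ≤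
      2 * Real.exp 1 * Real.exp (-((1 - 12 * |β'|) * T * ε ^ 2 / (4 * σ ^ 2 + 4 * ε))) := by
  classical
  haveI : IsProbabilityMeasure (wilsonMeasure (d := 3) (L := L) (fundamentalRep (Fin 2)) β') :=
    isProbabilityMeasure_wilsonMeasure (d := 3) (L := L) (fundamentalRep (Fin 2)) (continuous_fundamentalRep (Fin 2)) β'
  have hm1 : |∫ y, G y ∂(wilsonMeasure (d := 3) (L := L) (fundamentalRep (Fin 2)) β')| ≤ 1 :=
    abs_integral_le_of_abs_le_of_isProbabilityMeasure hG1
  have hGb : ∀ x, |G x - ∫ y, G y ∂(wilsonMeasure (d := 3) (L := L) (fundamentalRep (Fin 2)) β')| ≤ 2 := fun x =>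
    (abs_sub _ _).trans (by linarith [hG1 x, hm1])
  -- `G` and `−G`
  have hplus := coldStart_timeAverage_tail_le_bernstein_uniform L β' hβ z hW hU0 hU hG (by norm_num) hGb hσ hσ2 t₀ u ht₀ hT hε
  have hnegm : ∫ y, -G y ∂(wilsonMeasure (d := 3) (L := L) (fundamentalRep (Fin 2)) β') =
      -∫ y, G y ∂(wilsonMeasure (d := 3) (L := L) (fundamentalRep (Fin 2)) β') := integral_neg _
  have hGb' : ∀ x, |(-G x) - ∫ y, -G y ∂(wilsonMeasure (d := 3) (L := L) (fundamentalRep (Fin 2)) β')| ≤ 2 := fun x => by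
    rw [hnegm, show -G x - -∫ y, G y ∂(wilsonMeasure (d := 3) (L := L) (fundamentalRep (Fin 2)) β') =
      -(G x - ∫ y, G y ∂(wilsonMeasure (d := 3) (L := L) (fundamentalRep (Fin 2)) β')) by ring, abs_neg]
    exact hGb x
  have hσ2' : ∫ x, ((-G x) - ∫ y, -G y ∂(wilsonMeasure (d := 3) (L := L) (fundamentalRep (Fin 2)) β')) ^ 2
      ∂(wilsonMeasure (d := 3) (L := L) (fundamentalRep (Fin 2)) β') ≤ σ ^ 2 := by
    rw [hnegm]
    have e : (fun x => ((-G x) - -∫ y, G y ∂(wilsonMeasure (d := 3) (L := L) (fundamentalRep (Fin 2)) β')) ^ 2) =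
        fun x => (G x - ∫ y, G y ∂(wilsonMeasure (d := 3) (L := L) (fundamentalRep (Fin 2)) β')) ^ 2 := funext fun x => by ring
    rw [e]; exact hσ2
  have hminus := coldStart_timeAverage_tail_le_bernstein_uniform L β' hβ z hW hU0 hU (G := fun x => -G x) hG.neg (by norm_num) hGb'
    hσ hσ2' t₀ u ht₀ hT hε
  simp only [integral_neg] at hminus
  have hrate : (4 * σ ^ 2 + 2 * 2 * ε) = (4 * σ ^ 2 + 4 * ε) := by ring
  rw [hrate] at hplus hminus
  -- the two-sided event is the union of the one-sided events
  have hsub : {ω | ε ≤ |T⁻¹ * (∫ r in Ioc 0 T, G (U (2 + t₀ + u + r.toNNReal) ω)) -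
        ∫ y, G y ∂(wilsonMeasure (d := 3) (L := L) (fundamentalRep (Fin 2)) β')|} ⊆
      {ω | ε ≤ T⁻¹ * (∫ r in Ioc 0 T, G (U (2 + t₀ + u + r.toNNReal) ω)) -
          ∫ y, G y ∂(wilsonMeasure (d := 3) (L := L) (fundamentalRep (Fin 2)) β')} ∪
        {ω | ε ≤ T⁻¹ * (-(∫ r in Ioc 0 T, G (U (2 + t₀ + u + r.toNNReal) ω))) -
          -(∫ y, G y ∂(wilsonMeasure (d := 3) (L := L) (fundamentalRep (Fin 2)) β'))} := by
    intro ω hω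
    simp only [Set.mem_setOf_eq, Set.mem_union] at hω ⊢
    rcases le_abs'.1 hω with h | h
    · right; linarith
    · left; exact h
  calc P.real {ω | ε ≤ |T⁻¹ * (∫ r in Ioc 0 T, G (U (2 + t₀ + u + r.toNNReal) ω)) -
          ∫ y, G y ∂(wilsonMeasure (d := 3) (L := L) (fundamentalRep (Fin 2)) β')|}
      ≤ P.real ({ω | ε ≤ T⁻¹ * (∫ r in Ioc 0 T, G (U (2 + t₀ + u + r.toNNReal) ω)) -
            ∫ y, G y ∂(wilsonMeasure (d := 3) (L := L) (fundamentalRep (Fin 2)) β')} ∪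
          {ω | ε ≤ T⁻¹ * (-(∫ r in Ioc 0 T, G (U (2 + t₀ + u + r.toNNReal) ω))) -
            -(∫ y, G y ∂(wilsonMeasure (d := 3) (L := L) (fundamentalRep (Fin 2)) β'))}) := measureReal_mono hsub
    _ ≤ P.real {ω | ε ≤ T⁻¹ * (∫ r in Ioc 0 T, G (U (2 + t₀ + u + r.toNNReal) ω)) -
            ∫ y, G y ∂(wilsonMeasure (d := 3) (L := L) (fundamentalRep (Fin 2)) β')} +
          P.real {ω | ε ≤ T⁻¹ * (-(∫ r in Ioc 0 T, G (U (2 + t₀ + u + r.toNNReal) ω))) -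
            -(∫ y, G y ∂(wilsonMeasure (d := 3) (L := L) (fundamentalRep (Fin 2)) β'))} := measureReal_union_le _ _
    _ ≤ Real.exp 1 * Real.exp (-((1 - 12 * |β'|) * T * ε ^ 2 / (4 * σ ^ 2 + 4 * ε))) +
          Real.exp 1 * Real.exp (-((1 - 12 * |β'|) * T * ε ^ 2 / (4 * σ ^ 2 + 4 * ε))) := add_le_add hplus hminus
    _ = 2 * Real.exp 1 * Real.exp (-((1 - 12 * |β'|) * T * ε ^ 2 / (4 * σ ^ 2 + 4 * ε))) := by ring

end Summit.QuantumFields.YangMills.Theorems.ColdStartUniversality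

end
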